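import Literature.NumberTheory.Multiplicative.LiouvilleBlockEntropy
import HarnessLib

/-!
# Iterated approximate subadditivity of the Liouville block entropy

Topic `Literature/NumberTheory/Multiplicative`; continuation of `LiouvilleBlockEntropy.lean`
(kept separate to respect the 400-line guidance). Everything here is PROVED.

Iterating `liouvilleBlockEntropy_add_le` along multiples of a block length `M` (Tao 2016, §3:
"Iterating this, we conclude in particular that `𝐇(𝐗_{kH}) ≤ k 𝐇(𝐗_H) + o(1)`", here for the
empirical law at natural scale, with explicit errors):

* `liouvilleBlockEntropy_mul_le` — `𝐇_X(kM) ≤ k 𝐇_X(M) + ∑_{j<k} 2^M (φ(jM/X) + jM/X)` for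
  `kM ≤ X + M`;
* `tendsto_sum_liouvilleBlockEntropySubaddError` — that error tends to `0` as `X → ∞`;
* `liouvilleBlockEntropyRate_mul_le_add_littleO` — for `k ≥ 1`: `𝐇_X(kM)/(kM) ≤ 𝐇_X(M)/M + E(X)`
  with `E → 0`, valid for every `X` ((3.12) without the mutual-information gain); hence every
  subsequential limit `r(M) = lim 𝐇_X(M)/M` is antitone along multiples, `r(kM) ≤ r(M)` — the
  `RateAntitone` step of the birth skeleton of route EntropyRate (Parity), item UniformEntropyRate.

## References
* T. Tao, Forum Math. Pi 4 (2016) e8; arXiv:1509.05422, §3, the displays after (3.11) and (3.12).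
-/

open Finset Real Filter
open scoped Topology

noncomputable section

namespace Literature.NumberTheory.Multiplicative
open Literature.Probability.Entropy

/-- **Iterated approximate subadditivity** (Tao 2016, §3: "Iterating this, we conclude in
particular that `𝐇(𝐗_{kH}) ≤ k 𝐇(𝐗_H) + o(1)`", at natural scale with explicit errors): if
`kM ≤ X + M` (i.e. `(k-1)M ≤ X`, the last shift used) then
`𝐇_X(k M) ≤ k 𝐇_X(M) + ∑_{j<k} 2^M (φ(jM/X) + jM/X)`.
[cite: TaoFMP2016, §3 (display after (3.11), unconditional form)] -/
theorem liouvilleBlockEntropy_mul_le {X M k : ℕ} (hX : k * M ≤ X + M) :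
    liouvilleBlockEntropy X (k * M) ≤ k * liouvilleBlockEntropy X M +
      ∑ j ∈ Finset.range k, liouvilleBlockEntropySubaddError (j * M) M X := by
  induction k with
  | zero => simp
  | succ k ih =>
    have hkM : k * M ≤ X := by rw [Nat.succ_mul] at hX; omega
    have hk : k * M ≤ X + M := by omega
    have h1 := liouvilleBlockEntropy_add_le hkM M
    rw [Finset.sum_range_succ, Nat.succ_mul]
    push_cast
    linarith [ih hk]

/-- The iterated error `∑_{j<k} 2^M (φ(jM/X) + jM/X)` tends to `0` as `X → ∞`. [folklore] -/
theorem tendsto_sum_liouvilleBlockEntropySubaddError (M k : ℕ) :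
    Tendsto (fun X : ℕ => ∑ j ∈ Finset.range k, liouvilleBlockEntropySubaddError (j * M) M X)
      atTop (𝓝 0) := by
  have := tendsto_finsetSum (Finset.range k)
    (fun j _ => tendsto_liouvilleBlockEntropySubaddError (j * M) M)
  simpa using this

/-- **The rate along multiples, `o(1)` form**: for fixed `M` and `k ≥ 1` there is `E(X) → 0` with
`𝐇_X(kM)/(kM) ≤ 𝐇_X(M)/M + E(X)` for every `X` (Tao 2016, (3.12) without the mutual-information
gain, for the empirical law at natural scale). In particular any limit `r(M) = lim_X 𝐇_X(M)/M`
along a subsequence satisfies `r(kM) ≤ r(M)`. [cite: TaoFMP2016, §3 (3.12)] -/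
theorem liouvilleBlockEntropyRate_mul_le_add_littleO (M k : ℕ) (hk : 1 ≤ k) :
    ∃ E : ℕ → ℝ, Tendsto E atTop (𝓝 0) ∧ ∀ X : ℕ,
      liouvilleBlockEntropyRate X (k * M) ≤ liouvilleBlockEntropyRate X M + E X := by
  rcases Nat.eq_zero_or_pos M with rfl | hM
  · refine ⟨fun _ => 0, tendsto_const_nhds, fun X => ?_⟩
    simp [liouvilleBlockEntropyRate_def]
  have hkM : (0 : ℝ) < (k * M : ℕ) := by exact_mod_cast Nat.mul_pos hk hM
  refine ⟨fun X => if k * M ≤ X + M then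
      (∑ j ∈ Finset.range k, liouvilleBlockEntropySubaddError (j * M) M X) / ((k * M : ℕ) : ℝ)
    else Real.log 2, ?_, fun X => ?_⟩
  · have h := (tendsto_sum_liouvilleBlockEntropySubaddError M k).div_const ((k * M : ℕ) : ℝ)
    rw [zero_div] at h
    refine h.congr' ?_
    filter_upwards [eventually_ge_atTop (k * M)] with X hX
    rw [if_pos (by omega)]
  · dsimp only
    by_cases hX : k * M ≤ X + M
    · rw [if_pos hX, liouvilleBlockEntropyRate_def, liouvilleBlockEntropyRate_def,
        div_add_div _ _ (by positivity : (M : ℝ) ≠ 0) hkM.ne',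
        div_le_div_iff₀ hkM (by positivity)]
      have h := liouvilleBlockEntropy_mul_le hX
      have hM' : (0 : ℝ) < M := by exact_mod_cast hM
      push_cast at h ⊢
      nlinarith [h, hM'.le, mul_nonneg hM'.le (mul_nonneg (Nat.cast_nonneg k) hM'.le)]
    · rw [if_neg hX]
      linarith [liouvilleBlockEntropyRate_le_log_two X (k * M),
        liouvilleBlockEntropyRate_nonneg X M]

end Literature.NumberTheory.Multiplicative

end
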